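import Literature.AlgebraicGeometry.Motives.FiniteQuotientBaseChange
import Literature.AlgebraicGeometry.HodgeTheory.GlobalInvariantCycles
import Literature.AlgebraicGeometry.Resolution.QuasiProjectiveChowCover
import HarnessLib

/-!
# Finite-group quotients of QUASI-projective schemes over a field, and their base change to `ℂ`
# (SGA 1, Exp. V, Prop. 1.8/1.9; Mumford, *Abelian Varieties*, §7, Theorem p. 66 and Remark p. 69)

Topic `AlgebraicGeometry/Motives`; namespace `Literature.AlgebraicGeometry.Motives`. The sequel of the tree's
`Motives/FiniteQuotient` (`Motives.finiteQuotient ρ = X/G` for a finite group `G` acting on a separated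
`k`-scheme `X` whose `G`-STABLE AFFINE OPENS COVER `X` — Mumford's hypothesis, `hcov` below) and
`Motives/FiniteQuotientBaseChange` (`isSepQuotient_baseChangeHom_of_isProjectiveOver`: for a PROJECTIVE `Y`, a
quotient `p : Y ⟶ Z` by `Δ` for separated test objects commutes with `⊗_{L,τ} ℂ`), with «projective» relaxed to
«QUASI-projective» in the sense of the tree's `HodgeTheory.IsQuasiProjectiveOver` (an open `k`-immersion into a
projective `k`-scheme, `HodgeTheory/GlobalInvariantCycles`):

* `ActionOver.forall_exists_stableAffineOpen_of_isQuasiProjectiveOver` — Mumford's hypothesis HOLDS for a finite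
  group acting on a quasi-projective `k`-scheme: every orbit (a finite set of points of `X ↪ ℙⁿ_k`, an immersion)
  lies in an affine open (the tree's `Resolution.exists_isAffineOpen_finset_subset_of_isImmersion`, graded prime
  avoidance) hence in a `G`-stable affine open (`GaloisDescentScheme.forall_exists_stableAffineOpen`);
* `isSepQuotient_finiteQuotientMk` — the quotient map `Y ⟶ Y/Δ` IS a quotient for separated test objects
  (a geometric quotient is categorical: the tree's `isSepQuotient_of_isGeometricQuotient`);
* `isoFiniteQuotient_of_isSepQuotient_of_cover`, `isSepQuotient_baseChangeHom_of_cover` — the two theorems of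
  `FiniteQuotientBaseChange` with the hypothesis `IsProjectiveOver Y` replaced by exactly what their proofs use:
  `Y → Spec k` separated and the cover `hcov` (census: `IsProjectiveOver Y` entered those proofs only through
  `.isProper` ⇒ separated and through `forall_exists_stableAffineOpen_of_isProjectiveOver` ⇒ `hcov`; the proofs
  below are otherwise verbatim);
* `isSepQuotient_baseChangeHom_of_isQuasiProjectiveOver` — **finite-group quotients of quasi-projective
  `L`-schemes commute with base change to `ℂ`**: `isSepQuotient_baseChangeHom_of_isProjectiveOver` with
  `IsProjectiveOver Y ↦ IsQuasiProjectiveOver Y`, binders otherwise verbatim; and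
  `isSepQuotient_finiteQuotientMk_of_isQuasiProjectiveOver` — the quotient of a quasi-projective `Y` EXISTS as a
  quotient for separated test objects.

Consumer: the T3 v4 receptacle of the cell `hodgecm-mathlib` (crux `HDel`, `stub_Squot`: the finite Hecke quotient
of the QUASI-projective Siegel moduli scheme at principal level, [Deligne1971TravauxShimura] (5.11.1) / Cor. 5.7).
Everything is proved; no definitions, no named facts. Quasi-projectivity and separatedness of the inputs are the
tree's `HodgeTheory.IsQuasiProjectiveOver.baseChangeHom` (`HodgeGenericQbarDescentProofs`) and
`HodgeTheory.isSeparated_hom_of_isQuasiProjectiveOver` (`HodgeGenericQbarDescentFiniteMonodromyInputs`) — cited, not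
restated; where a statement needs `IsSeparated Y.hom` to SPELL `finiteQuotient`, it is a binder.

## References
* [SGA1] A. Grothendieck, *SGA 1*, Exp. V, §1, Prop. 1.8 and Prop. 1.9.
* [MumfordAV1970] D. Mumford, *Abelian Varieties* (1970), §7 Theorem p. 66 and Remark p. 69.
* [Liu2002] Q. Liu, *Algebraic Geometry and Arithmetic Curves* (2002), Prop. 3.3.36 (b).
-/

noncomputable section

open CategoryTheory CategoryTheory.Limits AlgebraicGeometry
open Literature.AlgebraicGeometry.RelativeSpec

universe u

/-! ### Orbits on a quasi-projective `k`-scheme lie in stable affine opens (SGA 1 V 1.8) -/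

namespace Literature.AlgebraicGeometry.RelativeSpec.ActionOver

variable {k : Type u} [Field k] {X : Literature.AlgebraicGeometry.Motives.SchemeOver k} {G : Type*}
  [Group G] [Finite G] (ρ : ActionOver X.hom G)

/-- **Every point of a quasi-projective `k`-scheme lies in a `G`-stable affine open** (`G` finite, acting by
`k`-automorphisms): SGA 1 V Prop. 1.8 «ceci est le cas si `X` est quasi-projectif» / Mumford AV §7 Remark p. 69.
An open immersion into a projective scheme followed by its closed immersion into `ℙⁿ_k` is an immersion, so every
finite set of points — in particular an orbit — lies in an affine open
(`Resolution.exists_isAffineOpen_finset_subset_of_isImmersion`), and the intersection of the translates of an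
affine open containing the orbit is a stable affine open (`GaloisDescentScheme.forall_exists_stableAffineOpen`; `X`
is separated, being open in a proper `k`-scheme). The projective case is the tree's
`forall_exists_stableAffineOpen_of_isProjectiveOver`. [cite: SGA1, Exp. V, Prop. 1.8] [cite: MumfordAV1970, §7 Remark p. 69] -/
theorem forall_exists_stableAffineOpen_of_isQuasiProjectiveOver
    (hX : Literature.AlgebraicGeometry.HodgeTheory.IsQuasiProjectiveOver X) (x : X.left) :
    ∃ O : ρ.StableAffineOpens, x ∈ O.1 := by
  obtain ⟨P, j, hP, hj⟩ := hX
  obtain ⟨n, ι, hι⟩ := hP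
  haveI := hι
  haveI := hj
  haveI : IsProper P.hom := Literature.AlgebraicGeometry.Motives.IsProjectiveOver.isProper ⟨n, ι, hι⟩
  haveI : IsSeparated X.hom := by rw [← Over.w j]; infer_instance
  haveI : X.left.IsSeparated := ⟨by rw [← terminal.comp_from X.hom]; infer_instance⟩
  refine Literature.AlgebraicGeometry.Motives.GaloisDescentScheme.forall_exists_stableAffineOpen ρ
    (fun S ↦ ?_) x
  exact Literature.AlgebraicGeometry.Resolution.exists_isAffineOpen_finset_subset_of_isImmersion
    (j.left ≫ ι.left) S

end Literature.AlgebraicGeometry.RelativeSpec.ActionOver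

namespace Literature.AlgebraicGeometry.Motives

/-- A `k`-scheme with separated structure map is a separated scheme. [folklore] -/
private theorem isSeparated_left_of_isSeparated_hom' {k : Type u} [Field k] (W : SchemeOver k)
    (hW : IsSeparated W.hom) : W.left.IsSeparated :=
  ⟨by rw [← terminal.comp_from W.hom]; infer_instance⟩

/-! ### Separated quotients under Mumford's covering hypothesis (`Y → Spec k` separated, `hcov`) -/

section Cover

variable {k : Type u} [Field k] {Δ : Type} [Group Δ] [Finite Δ] {Y Z : SchemeOver k}

/-- **The quotient map `Y ⟶ Y/Δ` is a quotient for separated test objects** (`Y → Spec k` separated, `Δ` finite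
acting by `k`-automorphisms `act`, stable affine opens covering `Y`): Mumford's Remark «`(Y, π)` is a categorical
quotient» — the quotient map is an affine GEOMETRIC quotient (`ActionOver.isGeometricQuotient_gluedMk`) and a
geometric quotient is a quotient for separated test objects (`isSepQuotient_of_isGeometricQuotient`). The action
enters as the `RelativeSpec.ActionOver` `⟨((Over.forget _).mapAut Y).comp act, _⟩` written inline, as in
`FiniteQuotientBaseChange`. [cite: MumfordAV1970, §7 Thm. p. 66 (Remark)] -/
theorem isSepQuotient_finiteQuotientMk [IsSeparated Y.hom] (act : Δ →* Aut Y)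
    (hcov : ∀ y : Y.left, ∃ O : (⟨((Over.forget _).mapAut Y).comp act, fun g => Over.w (act g).hom⟩ :
        ActionOver Y.hom Δ).StableAffineOpens, y ∈ O.1) :
    IsSepQuotient (fun g => act g)
      (finiteQuotient.mk (⟨((Over.forget _).mapAut Y).comp act, fun g => Over.w (act g).hom⟩ :
        ActionOver Y.hom Δ) hcov) := by
  let ρ : ActionOver Y.hom Δ := ⟨((Over.forget _).mapAut Y).comp act, fun g => Over.w (act g).hom⟩
  have hgq : ρ.IsGeometricQuotient (finiteQuotient.mk ρ hcov).left := ρ.isGeometricQuotient_gluedMk hcov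
  exact isSepQuotient_of_isGeometricQuotient _ _ ρ id id (fun _ => rfl) (fun _ => rfl) hgq

/-- **Uniqueness of the separated quotient** under Mumford's covering hypothesis: if `p : Y ⟶ Z` is a quotient of
the separated `k`-scheme `Y` by the finite group `Δ ≤ Aut_k(Y)` for separated test objects, `Z` is separated and
the `Δ`-stable affine opens cover `Y`, then `Z ≅ Y/Δ` under `Y` (`finiteQuotient.desc` / `desc_unique` against
`IsSepQuotient`). This is `isoFiniteQuotient_of_isSepQuotient` with `IsProjectiveOver Y` replaced by what its proof
uses. [cite: MumfordAV1970, §7 Thm. p. 66 (Remark)] -/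
theorem isoFiniteQuotient_of_isSepQuotient_of_cover [IsSeparated Y.hom] (act : Δ →* Aut Y)
    (hcov : ∀ y : Y.left, ∃ O : (⟨((Over.forget _).mapAut Y).comp act, fun g => Over.w (act g).hom⟩ :
        ActionOver Y.hom Δ).StableAffineOpens, y ∈ O.1)
    (p : Y ⟶ Z) (hZ : IsSeparated Z.hom) (hq : IsSepQuotient (fun g => act g) p) :
    ∃ i : Z ≅ finiteQuotient (⟨((Over.forget _).mapAut Y).comp act, fun g => Over.w (act g).hom⟩ :
        ActionOver Y.hom Δ),
      p ≫ i.hom = finiteQuotient.mk _ hcov := by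
  let ρ : ActionOver Y.hom Δ := ⟨((Over.forget _).mapAut Y).comp act, fun g => Over.w (act g).hom⟩
  have hov : ∀ g : Δ, (ρ.overIso g).hom = (act g).hom := fun g => Over.OverMorphism.ext rfl
  have hπ : ∀ g : Δ, (act g).hom ≫ finiteQuotient.mk ρ hcov = finiteQuotient.mk ρ hcov := fun g => by
    rw [← hov]; exact finiteQuotient.overIso_hom_mk ρ hcov g
  have hp : ∀ g : Δ, (ρ.overIso g).hom ≫ p = p := fun g => by rw [hov]; exact hq.hom_comp g
  haveI : Z.left.IsSeparated := isSeparated_left_of_isSeparated_hom' Z hZ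
  haveI : (finiteQuotient ρ).left.IsSeparated :=
    isSeparated_left_of_isSeparated_hom' _ (isSeparated_finiteQuotient_hom ρ hcov)
  obtain ⟨a, ha, -⟩ := hq.existsUnique (finiteQuotient.mk ρ hcov) (isSeparated_finiteQuotient_hom ρ hcov) hπ
  let b : finiteQuotient ρ ⟶ Z := finiteQuotient.desc ρ hcov p hp
  have hab : a ≫ b = 𝟙 Z := hq.hom_ext hZ (by rw [reassoc_of% ha, finiteQuotient.mk_desc, Category.comp_id])
  have hba : b ≫ a = 𝟙 _ := by
    rw [finiteQuotient.desc_unique ρ hcov (finiteQuotient.mk ρ hcov) hπ (b ≫ a)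
        (by rw [← Category.assoc, finiteQuotient.mk_desc, ha]),
      finiteQuotient.desc_unique ρ hcov (finiteQuotient.mk ρ hcov) hπ (𝟙 _) (Category.comp_id _)]
  exact ⟨⟨a, b, hab, hba⟩, ha⟩

end Cover

/-! ### Base change to `ℂ` under the covering hypothesis, and for quasi-projective sources (SGA 1 V 1.9) -/

set_option maxHeartbeats 400000 in
/-- **Finite-group quotients commute with base change to `ℂ`, under Mumford's covering hypothesis** (SGA 1,
Exp. V, Prop. 1.9 for the flat base change `Spec ℂ → Spec L`; Mumford AV §7 Thm. p. 66): `L` a field,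
`τ : L →+* ℂ`, `Δ` finite acting by `L`-automorphisms on the SEPARATED `L`-scheme `Y` whose `Δ`-stable affine
opens cover it, `p : Y ⟶ Z` a quotient for separated test objects with `Z` separated ⇒ `Z ⊗_{L,τ} ℂ` is separated
and `p ⊗_{L,τ} ℂ` is a quotient of `Y ⊗_{L,τ} ℂ` for separated test objects. Proof =
`isSepQuotient_baseChangeHom_of_isProjectiveOver` verbatim: `Z ≅ Y/Δ`; the quotient map is an affine geometric
quotient; geometric quotients commute with extension of the base field (`ActionOver.isGeometricQuotient_baseChange`)
and are quotients for separated test objects. [cite: SGA1, Exp. V Prop. 1.9] [cite: MumfordAV1970, §7 Thm. p. 66] -/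
theorem isSepQuotient_baseChangeHom_of_cover (L : Type) [Field L] (τ : L →+* ℂ) (Δ : Type)
    [Group Δ] [Fintype Δ] (Y Z : SchemeOver L) [IsSeparated Y.hom] (act : Δ →* Aut Y)
    (hcov : ∀ y : Y.left, ∃ O : (⟨((Over.forget _).mapAut Y).comp act, fun g => Over.w (act g).hom⟩ :
        ActionOver Y.hom Δ).StableAffineOpens, y ∈ O.1)
    (p : Y ⟶ Z) (hZ : IsSeparated Z.hom) (hq : IsSepQuotient (fun g => act g) p) :
    IsSeparated ((Motives.baseChangeHom τ).obj Z).hom ∧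
      IsSepQuotient (fun g => (Motives.baseChangeHom τ).mapIso (act g)) ((Motives.baseChangeHom τ).map p) := by
  refine ⟨?_, ?_⟩
  · haveI := hZ
    change IsSeparated (pullback.snd Z.hom (Spec.map (CommRingCat.ofHom τ)))
    infer_instance
  let ρ : ActionOver Y.hom Δ := ⟨((Over.forget _).mapAut Y).comp act, fun g => Over.w (act g).hom⟩
  obtain ⟨i, hi⟩ := isoFiniteQuotient_of_isSepQuotient_of_cover act hcov p hZ hq
  refine IsSepQuotient.of_comp_iso ((Motives.baseChangeHom τ).mapIso i) ?_
  rw [Functor.mapIso_hom, ← Functor.map_comp, hi]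
  have hgq : ρ.IsGeometricQuotient (finiteQuotient.mk ρ hcov).left := ρ.isGeometricQuotient_gluedMk hcov
  haveI : IsAffineHom (finiteQuotient.mk ρ hcov).left := finiteQuotient.isAffineHom_mk_left ρ hcov
  let act' : Δ →* Aut ((Motives.baseChangeHom τ).obj Y) := ((Motives.baseChangeHom τ).mapAut Y).comp act
  let ρ' : ActionOver ((Motives.baseChangeHom τ).obj Y).hom Δ :=
    ⟨((Over.forget _).mapAut _).comp act', fun g => Over.w (act' g).hom⟩
  have hρ' : ∀ g : Δ, (ρ'.aut g).hom ≫ pullback.fst Y.hom (Spec.map (CommRingCat.ofHom τ)) =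
      pullback.fst Y.hom (Spec.map (CommRingCat.ofHom τ)) ≫ (ρ.aut g).hom := fun g =>
    baseChangeHom_map_left_comp_fst τ (act g).hom
  have hgq' : ρ'.IsGeometricQuotient ((Motives.baseChangeHom τ).map (finiteQuotient.mk ρ hcov)).left :=
    ρ.isGeometricQuotient_baseChange τ (Over.w (finiteQuotient.mk ρ hcov)) hgq ρ' hρ' _
      (baseChangeHom_map_left_comp_fst τ (finiteQuotient.mk ρ hcov))
      (Over.w ((Motives.baseChangeHom τ).map (finiteQuotient.mk ρ hcov)))
  exact isSepQuotient_of_isGeometricQuotient _ _ ρ' id id (fun _ => rfl) (fun _ => rfl) hgq'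

/-- **Finite-group quotients of QUASI-PROJECTIVE schemes commute with base change to `ℂ`** (SGA 1, Exp. V,
Prop. 1.8 + 1.9; Mumford AV §7 Thm. p. 66 and Remark p. 69): the tree's `isSepQuotient_baseChangeHom_of_isProjectiveOver`
with `IsProjectiveOver Y` relaxed to `HodgeTheory.IsQuasiProjectiveOver Y`, binders otherwise verbatim — the
covering hypothesis holds by `ActionOver.forall_exists_stableAffineOpen_of_isQuasiProjectiveOver` and a
quasi-projective `L`-scheme is separated over `L`. This is leaf Q5 of the I-1′ receptacle plan (finite Hecke
quotients of the quasi-projective Siegel moduli scheme, [Deligne1971TravauxShimura] (5.11.1)).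
[cite: SGA1, Exp. V Prop. 1.8 and Prop. 1.9] [cite: MumfordAV1970, §7 Thm. p. 66 and Remark p. 69] -/
theorem isSepQuotient_baseChangeHom_of_isQuasiProjectiveOver (L : Type) [Field L] (τ : L →+* ℂ) (Δ : Type)
    [Group Δ] [Fintype Δ] (Y Z : SchemeOver L) (hY : HodgeTheory.IsQuasiProjectiveOver Y) (act : Δ →* Aut Y)
    (p : Y ⟶ Z) (hZ : IsSeparated Z.hom) (hq : IsSepQuotient (fun g => act g) p) :
    IsSeparated ((Motives.baseChangeHom τ).obj Z).hom ∧
      IsSepQuotient (fun g => (Motives.baseChangeHom τ).mapIso (act g)) ((Motives.baseChangeHom τ).map p) := by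
  haveI : IsSeparated Y.hom := by
    obtain ⟨P, j, hP, hj⟩ := hY
    haveI := hj
    haveI : IsProper P.hom := hP.isProper
    rw [← Over.w j]
    infer_instance
  exact isSepQuotient_baseChangeHom_of_cover L τ Δ Y Z act
    (ActionOver.forall_exists_stableAffineOpen_of_isQuasiProjectiveOver _ hY) p hZ hq

/-- **The quotient of a quasi-projective `k`-scheme by a finite group EXISTS as a quotient for separated test
objects**: for `Y` quasi-projective (and separated — automatic, `HodgeTheory.isSeparated_hom_of_isQuasiProjectiveOver`;
a binder here only to spell `finiteQuotient`) and `act : Δ →* Aut_k(Y)`, `Δ` finite, the tree's `Y/Δ = finiteQuotient`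
with its quotient map is an `IsSepQuotient` for `act` (SGA 1 V Prop. 1.8: «le quotient existe si X est
quasi-projectif»). [cite: SGA1, Exp. V, Prop. 1.8] [cite: MumfordAV1970, §7 Thm. p. 66 (Remark)] -/
theorem isSepQuotient_finiteQuotientMk_of_isQuasiProjectiveOver {k : Type u} [Field k] {Δ : Type} [Group Δ]
    [Finite Δ] {Y : SchemeOver k} [IsSeparated Y.hom] (hY : HodgeTheory.IsQuasiProjectiveOver Y)
    (act : Δ →* Aut Y) :
    IsSepQuotient (fun g => act g)
      (finiteQuotient.mk (⟨((Over.forget _).mapAut Y).comp act, fun g => Over.w (act g).hom⟩ :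
          ActionOver Y.hom Δ)
        (ActionOver.forall_exists_stableAffineOpen_of_isQuasiProjectiveOver _ hY)) :=
  isSepQuotient_finiteQuotientMk act _

end Literature.AlgebraicGeometry.Motives

end
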